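import Summits.QuantumFields.YangMills.Theorems.PoincareLipschitzSmallRangeOfOneStep
import HarnessLib

/-!
# Line «poincare_lipschitz» on crux `HistoryTailL` (stmt-QuantumFields-19936), K2 organ of record LOC-REG-MIN — E→R ROAD, BRICK F6-S: THE DOOR
# ‹ONE-STEP IMPROVEMENT WITH AN ADDITIVE SOURCE ⟹ SMALL RANGE› (the flat [C] with LEAD's TWIST SLACK `+ s(r)` carried through the iteration)

Cell `ym3-torus` (YM ladder rung R3 = continuum SU(2) Yang–Mills on the three-torus — a RUNG, NOT the Clay problem: not d = 4, not infinite volume, not a mass gap);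
width seat `ym3-torus-px8` gen 5 (LEAD ym-ust-19936-w1 g8 2026-08-29 06:02:29Z ASK «can the F6 door carry an additive `+ s(R)` in `hone`?» — answered YES 06:06Z; this
file is the bytes).  THEOREMS ONLY (def-free); `--supports stmt-QuantumFields-19936 --as helper`.  Sibling of ✓`PoincareLipschitzSmallRangeOfOneStep` (F6) and
✓`PoincareLipschitzSmallRangeOfOneStepPred`; NOTHING of F5, the twist slack, E→R, `hImprove`, `hRegH`, a stub, `BlockLipschitzL`, `HistoryTailL` or a summit statement
is proved here.

WHY.  [C] (E→R) is FLAT; [T2] ✓`PoincareLipschitzOrbitMinFlatShadow` + ✓∕⧗`…OrbitMinTwistSlack` make the torus minimiser's flat shadow an ALMOST-minimiser of the flat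
energy, `E(u;Q) ≤ E(v;Q) + s`, so F5's one-step improvement acquires an additive source: `E x ρ ≤ (A((ρ+1)∕r)^d + ε)·E x r + s r`.  The F6 iteration survives with
TWO smallness rows on the source — (i) THRESHOLD PROPAGATION `(2m^{d−1})⁻¹·T(m^{k+1}) + s(m^{k+1}) ≤ T(m^k)` and (ii) MORREY CLASS `s(m^k) ≤ N_s·(m^k)^{d−1}` — and NO
logarithmic loss, because the ladder ratio is halved: `θ := ½(m^{d−1})⁻¹` (price `2^{d+2}A ≤ m`, `ε ≤ ¼(m^{d−1})⁻¹`).  In normalised units (d = 3, top radius `R = m^K`):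
`ω ≲ m·√(E_top∕R) + m²·√(N_s·R)`.

* §1 ★ `geometric_decay_threshold_src` — abstract downward iteration WITH SOURCE: step `E (k+1) ≤ T (k+1) → E k ≤ (2B)⁻¹·E (k+1) + S (k+1)`, (i) `(2B)⁻¹T(k+1) + S(k+1)
  ≤ T k`, (ii) `S k ≤ N_s·B^k` (`1 ≤ k ≤ K`), `E K ≤ T K` ⟹ for all `k ≤ K`: `E k ≤ T k` and `E k ≤ ((2B)⁻¹)^{K−k}·E K + 2·B·N_s·B^k` (in the normalised letter
  `D k = E k∕B^k`: `D k ≤ ½D(k+1) + B·N_s`).  ★ `morrey_envelope_of_geometric_src` — monotone fill-in: `F ρ ≤ (m^p·F(m^K)∕(m^K)^p + 2(m^p)²N_s)·(ρ+1)^p` on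
  `0 ≤ ρ ≤ m^K`.
* §2 `geometricStep_of_oneStep_src` — BRIDGE from F5-with-slack (`hone_s`, harmonic ratio `((ρ+1)∕r)^d`, range `ρ + 1 ≤ r`) to the ladder step with `B = m^{d−1}`;
  `geometricStep_of_oneStep_src_pred` — the same in F5d-A's bookkeeping (`((ρ+1)∕(r−1))^d`, `ρ + 2 ≤ r`; `m ≥ 3`, `4^{d+1}A ≤ m`).
* §3 ★★ `morrey_at_centre_of_geometricStep_src`, ★★★ `norm_sub_le_of_oneStep_src` — THE DOOR WITH SOURCE: `‖u x′ − u a‖ ≤ 17·√(16d8^d)·√(N·(2ρ₀+1))`,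
  `N = m^{d−1}·Etop∕(m^K)^{d−1} + 2·(m^{d−1})²·N_s`, for every `x′ ∈ Q_{ρ₀}(a)`; ★★★ `norm_sub_le_of_oneStep_src_pred` — F5d-A bookkeeping.
[folklore] ([Giaquinta1984] Ch. III Lemma 2.1 (the additive slot `B·R^β`), Thm 1.2; [SchoenUhlenbeck1982] §4; lattice statements are this file's and F6's).
-/

set_option autoImplicit false

noncomputable section

open scoped BigOperators InnerProductSpace
open Finset

namespace Summit.QuantumFields.YangMills.Theorems.PoincareLipschitzSmallRangeOfOneStepSrc

open Literature.MathematicalPhysics.QuantumFieldTheory.Balaban1983to89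
open B4Eq19LatticeOperators
open Summit.QuantumFields.YangMills.Theorems.PoincareLipschitzSmallRangeOfOneStep (norm_sub_le_of_morrey)

variable {d : ℕ} {V : Type*} [NormedAddCommGroup V] [InnerProductSpace ℝ V]

/-! ## §1 Downward iteration with a threshold AND a source; the Morrey envelope -/

/-- ★ **DOWNWARD ITERATION WITH A PROPAGATING THRESHOLD AND A MORREY-CLASS SOURCE.**  Ratio `(2B)⁻¹`, source `S (k+1)` in the step, (i) `(2B)⁻¹·T(k+1) + S(k+1) ≤ T k`,
(ii) `S k ≤ N_s·B^k` for `1 ≤ k ≤ K`, top scale below threshold ⟹ every scale is below threshold and `E k ≤ ((2B)⁻¹)^{K−k}·E K + 2·B·N_s·B^k`.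
[folklore] [cite: Giaquinta1984, Ch. III Lemma 2.1 p.86] -/
theorem geometric_decay_threshold_src (E T S : ℕ → ℝ) {B Ns : ℝ} (hB : 0 < B) (hNs : 0 ≤ Ns) (K : ℕ)
    (hstep : ∀ k, k < K → E (k + 1) ≤ T (k + 1) → E k ≤ (2 * B)⁻¹ * E (k + 1) + S (k + 1))
    (hT : ∀ k, k < K → (2 * B)⁻¹ * T (k + 1) + S (k + 1) ≤ T k)
    (hS : ∀ k, 1 ≤ k → k ≤ K → S k ≤ Ns * B ^ k) (htop : E K ≤ T K) :
    ∀ k, k ≤ K → E k ≤ T k ∧ E k ≤ ((2 * B)⁻¹) ^ (K - k) * E K + 2 * B * Ns * B ^ k := by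
  have hθ : (0 : ℝ) ≤ (2 * B)⁻¹ := by positivity
  have main : ∀ j, j ≤ K → E (K - j) ≤ T (K - j) ∧ E (K - j) ≤ ((2 * B)⁻¹) ^ j * E K + 2 * B * Ns * B ^ (K - j) := by
    intro j
    induction j with
    | zero =>
      intro _
      simp only [Nat.sub_zero, pow_zero, one_mul]
      have h0 : 0 ≤ 2 * B * Ns * B ^ K := by positivity
      exact ⟨htop, by linarith⟩
    | succ j ih =>
      intro hj
      obtain ⟨ih1, ih2⟩ := ih (by omega)
      have hk : K - (j + 1) < K := by omega
      have hks : K - (j + 1) + 1 = K - j := by omega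
      have h1 := hstep (K - (j + 1)) hk (by rw [hks]; exact ih1)
      have h2 := hT (K - (j + 1)) hk
      have h3 := hS (K - j) (by omega) (Nat.sub_le _ _)
      rw [hks] at h1 h2
      refine ⟨?_, ?_⟩
      · calc E (K - (j + 1)) ≤ (2 * B)⁻¹ * E (K - j) + S (K - j) := h1
          _ ≤ (2 * B)⁻¹ * T (K - j) + S (K - j) := by
              have := mul_le_mul_of_nonneg_left ih1 hθ; linarith
          _ ≤ T (K - (j + 1)) := h2
      · have hpow : B ^ (K - j) = B * B ^ (K - (j + 1)) := by rw [← pow_succ', hks]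
        calc E (K - (j + 1)) ≤ (2 * B)⁻¹ * E (K - j) + S (K - j) := h1
          _ ≤ (2 * B)⁻¹ * (((2 * B)⁻¹) ^ j * E K + 2 * B * Ns * B ^ (K - j)) + Ns * B ^ (K - j) := by
              have := mul_le_mul_of_nonneg_left ih2 hθ; linarith
          _ = ((2 * B)⁻¹) ^ (j + 1) * E K + ((2 * B)⁻¹ * (2 * B) + 1) * (Ns * B ^ (K - j)) := by ring
          _ = ((2 * B)⁻¹) ^ (j + 1) * E K + 2 * B * Ns * B ^ (K - (j + 1)) := by
              rw [inv_mul_cancel₀ (by positivity : (2 : ℝ) * B ≠ 0), hpow]; ring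
  intro k hk
  have h := main (K - k) (Nat.sub_le _ _)
  rwa [Nat.sub_sub_self hk] at h

/-- ★ **THE MORREY ENVELOPE OF A GEOMETRIC DECAY WITH SOURCE ALONG `m^k`.**  `F : ℤ → ℝ` nonneg and monotone, `m ≥ 2`, `N_s ≥ 0`, and
`F(m^k) ≤ ((2m^p)⁻¹)^{K−k}·F(m^K) + 2·m^p·N_s·(m^p)^k` for `k ≤ K` ⟹ `F ρ ≤ (m^p·F(m^K)∕(m^K)^p + 2·(m^p)²·N_s)·(ρ+1)^p` for every `0 ≤ ρ ≤ m^K`. [folklore] -/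
theorem morrey_envelope_of_geometric_src (F : ℤ → ℝ) (hF0 : ∀ ρ, 0 ≤ F ρ) (hmono : ∀ ρ ρ', ρ ≤ ρ' → F ρ ≤ F ρ') {m : ℕ} (hm : 2 ≤ m) (p K : ℕ)
    {Ns : ℝ} (hNs : 0 ≤ Ns)
    (hdec : ∀ k, k ≤ K → F ((m : ℤ) ^ k) ≤ ((2 * (m : ℝ) ^ p)⁻¹) ^ (K - k) * F ((m : ℤ) ^ K) + 2 * (m : ℝ) ^ p * Ns * ((m : ℝ) ^ p) ^ k) :
    ∀ ρ : ℤ, 0 ≤ ρ → ρ ≤ (m : ℤ) ^ K →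
      F ρ ≤ ((m : ℝ) ^ p * F ((m : ℤ) ^ K) / ((m : ℝ) ^ K) ^ p + 2 * ((m : ℝ) ^ p) ^ 2 * Ns) * ((ρ : ℝ) + 1) ^ p := by
  classical
  intro ρ hρ0 hρK
  have hm0 : (0 : ℝ) < m := by exact_mod_cast (by omega : 0 < m)
  have hm1 : (1 : ℝ) ≤ m := by exact_mod_cast (by omega : 1 ≤ m)
  have hFt := hF0 ((m : ℤ) ^ K)
  have hρ0' : (0 : ℝ) ≤ ρ := by exact_mod_cast hρ0
  -- the least `k` with `ρ ≤ m^k`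
  have hex : ∃ k : ℕ, ρ ≤ (m : ℤ) ^ k := ⟨K, hρK⟩
  let k := Nat.find hex
  have hk : ρ ≤ (m : ℤ) ^ k := Nat.find_spec hex
  have hkK : k ≤ K := Nat.find_min' hex hρK
  have hlow : (m : ℝ) ^ k ≤ m * ((ρ : ℝ) + 1) := by
    by_cases hk0 : k = 0
    · rw [hk0, pow_zero]; nlinarith
    · obtain ⟨j, hj⟩ := Nat.exists_eq_succ_of_ne_zero hk0
      have hmin := Nat.find_min hex (show j < k by omega)
      push Not at hmin
      have hj' : ((m : ℝ)) ^ j < ρ := by exact_mod_cast hmin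
      rw [hj, pow_succ, mul_comm]
      exact mul_le_mul_of_nonneg_left (by linarith) hm0.le
  set a : ℝ := ((m : ℝ) ^ p) ^ (K - k) with ha
  set b : ℝ := ((m : ℝ) ^ k) ^ p with hb
  set c : ℝ := ((m : ℝ) ^ K) ^ p with hc
  have ha0 : 0 < a := by positivity
  have hb0 : 0 < b := by positivity
  have hc0 : 0 < c := by positivity
  have hab : a * b = c := by
    rw [ha, hb, hc, ← pow_mul, ← pow_mul, ← pow_mul, ← pow_add]
    congr 1
    rw [mul_comm k p, ← Nat.mul_add, Nat.sub_add_cancel hkK, mul_comm]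
  have hbX : b ≤ ((m : ℝ) * ((ρ : ℝ) + 1)) ^ p := pow_le_pow_left₀ (by positivity) hlow p
  have hbk : ((m : ℝ) ^ p) ^ k = b := by rw [hb, ← pow_mul, ← pow_mul, mul_comm]
  -- geometric part: `((2m^p)⁻¹)^{K-k} ≤ a⁻¹`
  have hgeo : ((2 * (m : ℝ) ^ p)⁻¹) ^ (K - k) ≤ a⁻¹ := by
    rw [ha, ← inv_pow]
    refine pow_le_pow_left₀ (by positivity) ?_ _
    rw [inv_le_inv₀ (by positivity) (by positivity)]
    have : (0 : ℝ) ≤ (m : ℝ) ^ p := by positivity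
    linarith
  have h1 : F ρ ≤ F ((m : ℤ) ^ k) := hmono _ _ hk
  have h2 := hdec k hkK
  have hpart1 : a⁻¹ * F ((m : ℤ) ^ K) ≤ ((m : ℝ) ^ p * F ((m : ℤ) ^ K) / ((m : ℝ) ^ K) ^ p) * ((ρ : ℝ) + 1) ^ p := by
    calc a⁻¹ * F ((m : ℤ) ^ K) = F ((m : ℤ) ^ K) * b / (a * b) := by field_simp
      _ = F ((m : ℤ) ^ K) * b / c := by rw [hab]
      _ ≤ F ((m : ℤ) ^ K) * ((m : ℝ) * ((ρ : ℝ) + 1)) ^ p / c := by gcongr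
      _ = ((m : ℝ) ^ p * F ((m : ℤ) ^ K) / ((m : ℝ) ^ K) ^ p) * ((ρ : ℝ) + 1) ^ p := by rw [hc, mul_pow]; ring
  have hpart2 : 2 * (m : ℝ) ^ p * Ns * ((m : ℝ) ^ p) ^ k ≤ 2 * ((m : ℝ) ^ p) ^ 2 * Ns * ((ρ : ℝ) + 1) ^ p := by
    rw [hbk]
    calc 2 * (m : ℝ) ^ p * Ns * b ≤ 2 * (m : ℝ) ^ p * Ns * ((m : ℝ) * ((ρ : ℝ) + 1)) ^ p :=
          mul_le_mul_of_nonneg_left hbX (by positivity)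
      _ = 2 * ((m : ℝ) ^ p) ^ 2 * Ns * ((ρ : ℝ) + 1) ^ p := by rw [mul_pow]; ring
  calc F ρ ≤ ((2 * (m : ℝ) ^ p)⁻¹) ^ (K - k) * F ((m : ℤ) ^ K) + 2 * (m : ℝ) ^ p * Ns * ((m : ℝ) ^ p) ^ k := h1.trans h2
    _ ≤ a⁻¹ * F ((m : ℤ) ^ K) + 2 * (m : ℝ) ^ p * Ns * ((m : ℝ) ^ p) ^ k := by
        have := mul_le_mul_of_nonneg_right hgeo hFt; linarith
    _ ≤ ((m : ℝ) ^ p * F ((m : ℤ) ^ K) / ((m : ℝ) ^ K) ^ p) * ((ρ : ℝ) + 1) ^ p + 2 * ((m : ℝ) ^ p) ^ 2 * Ns * ((ρ : ℝ) + 1) ^ p := by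
        linarith
    _ = ((m : ℝ) ^ p * F ((m : ℤ) ^ K) / ((m : ℝ) ^ K) ^ p + 2 * ((m : ℝ) ^ p) ^ 2 * Ns) * ((ρ : ℝ) + 1) ^ p := by ring

/-! ## §2 Bridges from F5-with-slack to the ladder step (ratio `(2m^{d−1})⁻¹`) -/

/-- **BRIDGE WITH SOURCE** (F6 bookkeeping: ratio `((ρ+1)∕r)^d`, range `ρ + 1 ≤ r`).  `E ≥ 0`, `A ≥ 0`, `m ≥ 2`, `2^{d+2}·A ≤ m`, `ε ≤ ¼(m^{d−1})⁻¹` ⟹ at `ρ = m^k`,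
`r = m^{k+1}`: `E(m^k) ≤ (2m^{d−1})⁻¹·E(m^{k+1}) + s(m^{k+1})`. [folklore] -/
theorem geometricStep_of_oneStep_src (hd : 1 ≤ d) (E T s : ℤ → ℝ) (hE0 : ∀ ρ, 0 ≤ E ρ) {A ε : ℝ} (hA : 0 ≤ A) {m : ℕ} (hm : 2 ≤ m)
    (hmA : (2 : ℝ) ^ (d + 2) * A ≤ m) (hε : ε ≤ 1 / 4 * ((m : ℝ) ^ (d - 1))⁻¹) (K : ℕ)
    (hone : ∀ ρ r : ℤ, 1 ≤ ρ → ρ + 1 ≤ r → r ≤ (m : ℤ) ^ K → E r ≤ T r → E ρ ≤ (A * (((ρ : ℝ) + 1) / r) ^ d + ε) * E r + s r) :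
    ∀ k, k < K → E ((m : ℤ) ^ (k + 1)) ≤ T ((m : ℤ) ^ (k + 1)) →
      E ((m : ℤ) ^ k) ≤ (2 * (m : ℝ) ^ (d - 1))⁻¹ * E ((m : ℤ) ^ (k + 1)) + s ((m : ℤ) ^ (k + 1)) := by
  intro k hk hthr
  have hm0 : (0 : ℝ) < m := by exact_mod_cast (by omega : 0 < m)
  have hm2 : (2 : ℝ) ≤ m := by exact_mod_cast hm
  have hmz1 : (1 : ℤ) ≤ (m : ℤ) ^ k := one_le_pow₀ (by exact_mod_cast (by omega : 1 ≤ m))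
  have hmz2 : (m : ℤ) ^ k + 1 ≤ (m : ℤ) ^ (k + 1) := by
    have h1 : (m : ℤ) ^ k * 2 ≤ (m : ℤ) ^ k * m := mul_le_mul_of_nonneg_left (by exact_mod_cast hm) (by positivity)
    rw [pow_succ]; linarith
  have hmz3 : (m : ℤ) ^ (k + 1) ≤ (m : ℤ) ^ K := pow_le_pow_right₀ (by exact_mod_cast (by omega : 1 ≤ m)) (by omega)
  have h := hone ((m : ℤ) ^ k) ((m : ℤ) ^ (k + 1)) hmz1 hmz2 hmz3 hthr
  have hEr := hE0 ((m : ℤ) ^ (k + 1))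
  have hratio : (((((m : ℤ) ^ k : ℤ) : ℝ) + 1) / (((m : ℤ) ^ (k + 1) : ℤ) : ℝ)) ^ d ≤ (2 / (m : ℝ)) ^ d := by
    push_cast
    refine pow_le_pow_left₀ (by positivity) ?_ d
    rw [div_le_div_iff₀ (by positivity) hm0, pow_succ]
    have : (1 : ℝ) ≤ (m : ℝ) ^ k := one_le_pow₀ (by linarith)
    nlinarith
  have hkey : A * (2 / (m : ℝ)) ^ d + ε ≤ (2 * (m : ℝ) ^ (d - 1))⁻¹ := by
    obtain ⟨d', rfl⟩ : ∃ d', d = d' + 1 := ⟨d - 1, by omega⟩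
    simp only [add_tsub_cancel_right] at hε ⊢
    have hmd : (0 : ℝ) < (m : ℝ) ^ d' := pow_pos hm0 d'
    have e1 : A * (2 / (m : ℝ)) ^ (d' + 1) = (2 ^ (d' + 1) * A) / m * ((m : ℝ) ^ d')⁻¹ := by
      rw [div_pow, pow_succ (m : ℝ) d']
      field_simp
    have e2 : (2 : ℝ) ^ (d' + 1) * A / m ≤ 1 / 4 := by
      rw [div_le_iff₀ hm0]
      have : (2 : ℝ) ^ (d' + 1 + 2) * A ≤ m := hmA
      rw [pow_add] at this
      nlinarith
    have e3 : (2 * (m : ℝ) ^ d')⁻¹ = 1 / 2 * ((m : ℝ) ^ d')⁻¹ := by rw [mul_inv, one_div]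
    rw [e1, e3]
    have := mul_le_mul_of_nonneg_right e2 (inv_pos.2 hmd).le
    linarith
  calc E ((m : ℤ) ^ k) ≤ (A * (((((m : ℤ) ^ k : ℤ) : ℝ) + 1) / (((m : ℤ) ^ (k + 1) : ℤ) : ℝ)) ^ d + ε) * E ((m : ℤ) ^ (k + 1)) + s ((m : ℤ) ^ (k + 1)) := h
    _ ≤ (A * (2 / (m : ℝ)) ^ d + ε) * E ((m : ℤ) ^ (k + 1)) + s ((m : ℤ) ^ (k + 1)) := by
        have h1 : A * (((((m : ℤ) ^ k : ℤ) : ℝ) + 1) / (((m : ℤ) ^ (k + 1) : ℤ) : ℝ)) ^ d ≤ A * (2 / (m : ℝ)) ^ d :=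
          mul_le_mul_of_nonneg_left hratio hA
        have := mul_le_mul_of_nonneg_right (add_le_add_right h1 ε) hEr
        linarith
    _ ≤ (2 * (m : ℝ) ^ (d - 1))⁻¹ * E ((m : ℤ) ^ (k + 1)) + s ((m : ℤ) ^ (k + 1)) := by
        have := mul_le_mul_of_nonneg_right hkey hEr; linarith

/-- **BRIDGE WITH SOURCE, F5d-A BOOKKEEPING** (ratio `((ρ+1)∕(r−1))^d`, range `ρ + 2 ≤ r`; `m ≥ 3`, `4^{d+1}·A ≤ m`, `ε ≤ ¼(m^{d−1})⁻¹`). [folklore] -/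
theorem geometricStep_of_oneStep_src_pred (hd : 1 ≤ d) (E T s : ℤ → ℝ) (hE0 : ∀ ρ, 0 ≤ E ρ) {A ε : ℝ} (hA : 0 ≤ A) {m : ℕ} (hm : 3 ≤ m)
    (hmA : (4 : ℝ) ^ (d + 1) * A ≤ m) (hε : ε ≤ 1 / 4 * ((m : ℝ) ^ (d - 1))⁻¹) (K : ℕ)
    (hone : ∀ ρ r : ℤ, 1 ≤ ρ → ρ + 2 ≤ r → r ≤ (m : ℤ) ^ K → E r ≤ T r →
      E ρ ≤ (A * (((ρ : ℝ) + 1) / ((r : ℝ) - 1)) ^ d + ε) * E r + s r) :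
    ∀ k, k < K → E ((m : ℤ) ^ (k + 1)) ≤ T ((m : ℤ) ^ (k + 1)) →
      E ((m : ℤ) ^ k) ≤ (2 * (m : ℝ) ^ (d - 1))⁻¹ * E ((m : ℤ) ^ (k + 1)) + s ((m : ℤ) ^ (k + 1)) := by
  intro k hk hthr
  have hm0 : (0 : ℝ) < m := by exact_mod_cast (by omega : 0 < m)
  have hm3 : (3 : ℝ) ≤ m := by exact_mod_cast hm
  have hmz1 : (1 : ℤ) ≤ (m : ℤ) ^ k := one_le_pow₀ (by exact_mod_cast (by omega : 1 ≤ m))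
  have hmz2 : (m : ℤ) ^ k + 2 ≤ (m : ℤ) ^ (k + 1) := by
    have h1 : (m : ℤ) ^ k * 3 ≤ (m : ℤ) ^ k * m := mul_le_mul_of_nonneg_left (by exact_mod_cast hm) (by positivity)
    rw [pow_succ]; linarith
  have hmz3 : (m : ℤ) ^ (k + 1) ≤ (m : ℤ) ^ K := pow_le_pow_right₀ (by exact_mod_cast (by omega : 1 ≤ m)) (by omega)
  have h := hone ((m : ℤ) ^ k) ((m : ℤ) ^ (k + 1)) hmz1 hmz2 hmz3 hthr
  have hEr := hE0 ((m : ℤ) ^ (k + 1))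
  have hmk1 : (1 : ℝ) ≤ (m : ℝ) ^ k := one_le_pow₀ (by linarith)
  have hden : (0 : ℝ) < (m : ℝ) ^ (k + 1) - 1 := by
    have : (m : ℝ) ^ k * 3 ≤ (m : ℝ) ^ k * m := mul_le_mul_of_nonneg_left hm3 (by positivity)
    rw [pow_succ]; nlinarith
  have hratio : (((((m : ℤ) ^ k : ℤ) : ℝ) + 1) / ((((m : ℤ) ^ (k + 1) : ℤ) : ℝ) - 1)) ^ d ≤ (4 / (m : ℝ)) ^ d := by
    push_cast
    refine pow_le_pow_left₀ (div_nonneg (by positivity) hden.le) ?_ d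
    rw [div_le_div_iff₀ hden hm0, pow_succ]
    nlinarith
  have hkey : A * (4 / (m : ℝ)) ^ d + ε ≤ (2 * (m : ℝ) ^ (d - 1))⁻¹ := by
    obtain ⟨d', rfl⟩ : ∃ d', d = d' + 1 := ⟨d - 1, by omega⟩
    simp only [add_tsub_cancel_right] at hε ⊢
    have hmd : (0 : ℝ) < (m : ℝ) ^ d' := pow_pos hm0 d'
    have e1 : A * (4 / (m : ℝ)) ^ (d' + 1) = (4 ^ (d' + 1) * A) / m * ((m : ℝ) ^ d')⁻¹ := by
      rw [div_pow, pow_succ (m : ℝ) d']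
      field_simp
    have e2 : (4 : ℝ) ^ (d' + 1) * A / m ≤ 1 / 4 := by
      rw [div_le_iff₀ hm0]
      have : (4 : ℝ) ^ (d' + 1 + 1) * A ≤ m := hmA
      rw [pow_succ] at this
      nlinarith
    have e3 : (2 * (m : ℝ) ^ d')⁻¹ = 1 / 2 * ((m : ℝ) ^ d')⁻¹ := by rw [mul_inv, one_div]
    rw [e1, e3]
    have := mul_le_mul_of_nonneg_right e2 (inv_pos.2 hmd).le
    linarith
  calc E ((m : ℤ) ^ k)
      ≤ (A * (((((m : ℤ) ^ k : ℤ) : ℝ) + 1) / ((((m : ℤ) ^ (k + 1) : ℤ) : ℝ) - 1)) ^ d + ε) * E ((m : ℤ) ^ (k + 1)) + s ((m : ℤ) ^ (k + 1)) := h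
    _ ≤ (A * (4 / (m : ℝ)) ^ d + ε) * E ((m : ℤ) ^ (k + 1)) + s ((m : ℤ) ^ (k + 1)) := by
        have h1 : A * (((((m : ℤ) ^ k : ℤ) : ℝ) + 1) / ((((m : ℤ) ^ (k + 1) : ℤ) : ℝ) - 1)) ^ d ≤ A * (4 / (m : ℝ)) ^ d :=
          mul_le_mul_of_nonneg_left hratio hA
        have := mul_le_mul_of_nonneg_right (add_le_add_right h1 ε) hEr
        linarith
    _ ≤ (2 * (m : ℝ) ^ (d - 1))⁻¹ * E ((m : ℤ) ^ (k + 1)) + s ((m : ℤ) ^ (k + 1)) := by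
        have := mul_le_mul_of_nonneg_right hkey hEr; linarith

/-! ## §3 The door with source -/

/-- ★★ **MORREY AT ONE CENTRE FROM THE LADDER STEP WITH SOURCE.**  `E x · ≥ 0` monotone, ladder step `E x (m^{k+1}) ≤ T(m^{k+1}) → E x (m^k) ≤ (2m^{d−1})⁻¹E x (m^{k+1})
+ s(m^{k+1})`, (i) `(2m^{d−1})⁻¹T(m^{k+1}) + s(m^{k+1}) ≤ T(m^k)`, (ii) `s(m^k) ≤ N_s·(m^k)^{d−1}` (`1 ≤ k ≤ K`), top scale below threshold ⟹
`E x ρ ≤ (m^{d−1}·E x (m^K)∕(m^K)^{d−1} + 2(m^{d−1})²N_s)·(ρ+1)^{d−1}` for all `0 ≤ ρ ≤ m^K`. [folklore] -/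
theorem morrey_at_centre_of_geometricStep_src (E : Zd d → ℤ → ℝ) (x : Zd d) (hE0 : ∀ ρ, 0 ≤ E x ρ) (hmono : ∀ ρ ρ', ρ ≤ ρ' → E x ρ ≤ E x ρ')
    (T s : ℤ → ℝ) {m : ℕ} (hm : 2 ≤ m) (K : ℕ) {Ns : ℝ} (hNs : 0 ≤ Ns)
    (hT : ∀ k, k < K → (2 * (m : ℝ) ^ (d - 1))⁻¹ * T ((m : ℤ) ^ (k + 1)) + s ((m : ℤ) ^ (k + 1)) ≤ T ((m : ℤ) ^ k))
    (hS : ∀ k, 1 ≤ k → k ≤ K → s ((m : ℤ) ^ k) ≤ Ns * ((m : ℝ) ^ (d - 1)) ^ k)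
    (hstep : ∀ k, k < K → E x ((m : ℤ) ^ (k + 1)) ≤ T ((m : ℤ) ^ (k + 1)) →
      E x ((m : ℤ) ^ k) ≤ (2 * (m : ℝ) ^ (d - 1))⁻¹ * E x ((m : ℤ) ^ (k + 1)) + s ((m : ℤ) ^ (k + 1)))
    (htop : E x ((m : ℤ) ^ K) ≤ T ((m : ℤ) ^ K)) :
    ∀ ρ : ℤ, 0 ≤ ρ → ρ ≤ (m : ℤ) ^ K →
      E x ρ ≤ ((m : ℝ) ^ (d - 1) * E x ((m : ℤ) ^ K) / ((m : ℝ) ^ K) ^ (d - 1) + 2 * ((m : ℝ) ^ (d - 1)) ^ 2 * Ns) * ((ρ : ℝ) + 1) ^ (d - 1) := by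
  have hm0 : (0 : ℝ) < m := by exact_mod_cast (by omega : 0 < m)
  have hB : (0 : ℝ) < (m : ℝ) ^ (d - 1) := pow_pos hm0 _
  have hdec := geometric_decay_threshold_src (fun k => E x ((m : ℤ) ^ k)) (fun k => T ((m : ℤ) ^ k)) (fun k => s ((m : ℤ) ^ k)) hB hNs K
    hstep hT hS htop
  exact morrey_envelope_of_geometric_src (E x) hE0 hmono hm (d - 1) K hNs fun k hk => (hdec k hk).2

/-- ★★★ **THE DOOR WITH SOURCE ‹ONE-STEP IMPROVEMENT + SLACK ⟹ SMALL RANGE›.**  `d ≥ 1`, `u : ℤ^d → V` (`V` any real inner-product space), energy letter `E`, constants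
`A ≥ 0`, `ε ≤ ¼(m^{d−1})⁻¹`, integer ratio `m ≥ 2` with `2^{d+2}·A ≤ m`, threshold `T`, source `s` with rows (i) `(2m^{d−1})⁻¹·T(m^{k+1}) + s(m^{k+1}) ≤ T(m^k)` and
(ii) `s(m^k) ≤ N_s·(m^{d−1})^k` (`1 ≤ k ≤ K`), `1 ≤ ρ₀`, `2ρ₀ ≤ m^K`.  HYPOTHESIS `hone` (the one-step improvement WITH SLACK, at every centre of `Q_{ρ₀}(a)`, all
`1 ≤ ρ`, `ρ + 1 ≤ r ≤ m^K`): `E x r ≤ T r → E x ρ ≤ (A·((ρ+1)∕r)^d + ε)·E x r + s r`; top scale: `E x (m^K) ≤ Etop` and `≤ T(m^K)` on `Q_{ρ₀}(a)`.  CONCLUSION: for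
every `x′ ∈ Q_{ρ₀}(a)`, `‖u x′ − u a‖ ≤ 17·√(16·d·8^d)·√(N·(2ρ₀+1))`, `N = m^{d−1}·Etop∕(m^K)^{d−1} + 2·(m^{d−1})²·N_s`.
[folklore] [cite: Giaquinta1984, Ch. III Lemma 2.1 p.86, Thm 1.2 p.70; SchoenUhlenbeck1982, §4] -/
theorem norm_sub_le_of_oneStep_src (hd : 1 ≤ d) (u : Zd d → V) (E : Zd d → ℤ → ℝ)
    (hE : ∀ x ρ, E x ρ = ∑ y ∈ box x ρ, ∑ μ, ‖u (y + unitVec μ) - u y‖ ^ 2)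
    (T s : ℤ → ℝ) {A ε : ℝ} (hA : 0 ≤ A) {m : ℕ} (hm : 2 ≤ m) (hmA : (2 : ℝ) ^ (d + 2) * A ≤ m) (hε : ε ≤ 1 / 4 * ((m : ℝ) ^ (d - 1))⁻¹)
    (K : ℕ) {Ns : ℝ} (hNs : 0 ≤ Ns) (a : Zd d) {ρ₀ : ℕ} (hρ₀ : 1 ≤ ρ₀) (h2ρ₀ : 2 * (ρ₀ : ℤ) ≤ (m : ℤ) ^ K)
    (hT : ∀ k, k < K → (2 * (m : ℝ) ^ (d - 1))⁻¹ * T ((m : ℤ) ^ (k + 1)) + s ((m : ℤ) ^ (k + 1)) ≤ T ((m : ℤ) ^ k))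
    (hS : ∀ k, 1 ≤ k → k ≤ K → s ((m : ℤ) ^ k) ≤ Ns * ((m : ℝ) ^ (d - 1)) ^ k)
    (hone : ∀ x ∈ box a (ρ₀ : ℤ), ∀ ρ r : ℤ, 1 ≤ ρ → ρ + 1 ≤ r → r ≤ (m : ℤ) ^ K → E x r ≤ T r →
      E x ρ ≤ (A * (((ρ : ℝ) + 1) / r) ^ d + ε) * E x r + s r)
    {Etop : ℝ} (htop : ∀ x ∈ box a (ρ₀ : ℤ), E x ((m : ℤ) ^ K) ≤ Etop) (hthr : ∀ x ∈ box a (ρ₀ : ℤ), E x ((m : ℤ) ^ K) ≤ T ((m : ℤ) ^ K)) :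
    ∀ x' ∈ box a (ρ₀ : ℤ), ‖u x' - u a‖ ≤ 17 * Real.sqrt (16 * d * 8 ^ d) *
      Real.sqrt (((m : ℝ) ^ (d - 1) * Etop / ((m : ℝ) ^ K) ^ (d - 1) + 2 * ((m : ℝ) ^ (d - 1)) ^ 2 * Ns) * (2 * (ρ₀ : ℝ) + 1)) := by
  intro x' hx'
  have hm0 : (0 : ℝ) < m := by exact_mod_cast (by omega : 0 < m)
  have hE0 : ∀ x ρ, 0 ≤ E x ρ := fun x ρ => by
    rw [hE]; exact Finset.sum_nonneg fun _ _ => Finset.sum_nonneg fun _ _ => sq_nonneg _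
  have hmono : ∀ x (ρ ρ' : ℤ), ρ ≤ ρ' → E x ρ ≤ E x ρ' := fun x ρ ρ' h => by
    rw [hE, hE]
    exact Finset.sum_le_sum_of_subset_of_nonneg (box_mono x h) fun _ _ _ => Finset.sum_nonneg fun _ _ => sq_nonneg _
  have ha : a ∈ box a (ρ₀ : ℤ) := self_mem_box a (by positivity)
  have hEtop0 : 0 ≤ Etop := (hE0 a _).trans (htop a ha)
  set N : ℝ := (m : ℝ) ^ (d - 1) * Etop / ((m : ℝ) ^ K) ^ (d - 1) + 2 * ((m : ℝ) ^ (d - 1)) ^ 2 * Ns with hN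
  have hN0 : 0 ≤ N := by rw [hN]; positivity
  have hMor : ∀ x ∈ box a (ρ₀ : ℤ), ∀ ρ : ℤ, 0 ≤ ρ → ρ ≤ (m : ℤ) ^ K →
      ∑ y ∈ box x ρ, ∑ μ, ‖u (y + unitVec μ) - u y‖ ^ 2 ≤ N * ((ρ : ℝ) + 1) ^ (d - 1) := by
    intro x hx ρ hρ hρK
    have h := morrey_at_centre_of_geometricStep_src E x (hE0 x) (hmono x) T s hm K hNs hT hS
      (fun k hk => geometricStep_of_oneStep_src hd (E x) T s (hE0 x) hA hm hmA hε K (hone x hx) k hk) (hthr x hx) ρ hρ hρK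
    rw [← hE]
    refine h.trans (mul_le_mul_of_nonneg_right ?_ (by positivity))
    rw [hN]
    gcongr
    exact htop x hx
  exact norm_sub_le_of_morrey hd u hρ₀ hx' hN0 h2ρ₀ (hMor a ha) (hMor x' hx')

/-- ★★★ **THE DOOR WITH SOURCE, F5d-A BOOKKEEPING** (`hone` asked on `ρ + 2 ≤ r` with ratio `((ρ+1)∕(r−1))^d`; `m ≥ 3`, `4^{d+1}·A ≤ m`). [folklore]
[cite: Giaquinta1984, Ch. III Lemma 2.1 p.86, Thm 1.2 p.70; SchoenUhlenbeck1982, §4] -/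
theorem norm_sub_le_of_oneStep_src_pred (hd : 1 ≤ d) (u : Zd d → V) (E : Zd d → ℤ → ℝ)
    (hE : ∀ x ρ, E x ρ = ∑ y ∈ box x ρ, ∑ μ, ‖u (y + unitVec μ) - u y‖ ^ 2)
    (T s : ℤ → ℝ) {A ε : ℝ} (hA : 0 ≤ A) {m : ℕ} (hm : 3 ≤ m) (hmA : (4 : ℝ) ^ (d + 1) * A ≤ m) (hε : ε ≤ 1 / 4 * ((m : ℝ) ^ (d - 1))⁻¹)
    (K : ℕ) {Ns : ℝ} (hNs : 0 ≤ Ns) (a : Zd d) {ρ₀ : ℕ} (hρ₀ : 1 ≤ ρ₀) (h2ρ₀ : 2 * (ρ₀ : ℤ) ≤ (m : ℤ) ^ K)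
    (hT : ∀ k, k < K → (2 * (m : ℝ) ^ (d - 1))⁻¹ * T ((m : ℤ) ^ (k + 1)) + s ((m : ℤ) ^ (k + 1)) ≤ T ((m : ℤ) ^ k))
    (hS : ∀ k, 1 ≤ k → k ≤ K → s ((m : ℤ) ^ k) ≤ Ns * ((m : ℝ) ^ (d - 1)) ^ k)
    (hone : ∀ x ∈ box a (ρ₀ : ℤ), ∀ ρ r : ℤ, 1 ≤ ρ → ρ + 2 ≤ r → r ≤ (m : ℤ) ^ K → E x r ≤ T r →
      E x ρ ≤ (A * (((ρ : ℝ) + 1) / ((r : ℝ) - 1)) ^ d + ε) * E x r + s r)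
    {Etop : ℝ} (htop : ∀ x ∈ box a (ρ₀ : ℤ), E x ((m : ℤ) ^ K) ≤ Etop) (hthr : ∀ x ∈ box a (ρ₀ : ℤ), E x ((m : ℤ) ^ K) ≤ T ((m : ℤ) ^ K)) :
    ∀ x' ∈ box a (ρ₀ : ℤ), ‖u x' - u a‖ ≤ 17 * Real.sqrt (16 * d * 8 ^ d) *
      Real.sqrt (((m : ℝ) ^ (d - 1) * Etop / ((m : ℝ) ^ K) ^ (d - 1) + 2 * ((m : ℝ) ^ (d - 1)) ^ 2 * Ns) * (2 * (ρ₀ : ℝ) + 1)) := by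
  intro x' hx'
  have hm0 : (0 : ℝ) < m := by exact_mod_cast (by omega : 0 < m)
  have hE0 : ∀ x ρ, 0 ≤ E x ρ := fun x ρ => by
    rw [hE]; exact Finset.sum_nonneg fun _ _ => Finset.sum_nonneg fun _ _ => sq_nonneg _
  have hmono : ∀ x (ρ ρ' : ℤ), ρ ≤ ρ' → E x ρ ≤ E x ρ' := fun x ρ ρ' h => by
    rw [hE, hE]
    exact Finset.sum_le_sum_of_subset_of_nonneg (box_mono x h) fun _ _ _ => Finset.sum_nonneg fun _ _ => sq_nonneg _
  have ha : a ∈ box a (ρ₀ : ℤ) := self_mem_box a (by positivity)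
  have hEtop0 : 0 ≤ Etop := (hE0 a _).trans (htop a ha)
  set N : ℝ := (m : ℝ) ^ (d - 1) * Etop / ((m : ℝ) ^ K) ^ (d - 1) + 2 * ((m : ℝ) ^ (d - 1)) ^ 2 * Ns with hN
  have hN0 : 0 ≤ N := by rw [hN]; positivity
  have hMor : ∀ x ∈ box a (ρ₀ : ℤ), ∀ ρ : ℤ, 0 ≤ ρ → ρ ≤ (m : ℤ) ^ K →
      ∑ y ∈ box x ρ, ∑ μ, ‖u (y + unitVec μ) - u y‖ ^ 2 ≤ N * ((ρ : ℝ) + 1) ^ (d - 1) := by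
    intro x hx ρ hρ hρK
    have h := morrey_at_centre_of_geometricStep_src E x (hE0 x) (hmono x) T s (by omega) K hNs hT hS
      (fun k hk => geometricStep_of_oneStep_src_pred hd (E x) T s (hE0 x) hA hm hmA hε K (hone x hx) k hk) (hthr x hx) ρ hρ hρK
    rw [← hE]
    refine h.trans (mul_le_mul_of_nonneg_right ?_ (by positivity))
    rw [hN]
    gcongr
    exact htop x hx
  exact norm_sub_le_of_morrey hd u hρ₀ hx' hN0 h2ρ₀ (hMor a ha) (hMor x' hx')

end Summit.QuantumFields.YangMills.Theorems.PoincareLipschitzSmallRangeOfOneStepSrc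

end
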